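import Mathlib
import HarnessLib
import Literature.Computability.AlgebraicComplexity.MatMulPolystableProofs
import Literature.Computability.AlgebraicComplexity.BI17FundamentalInvariantTensors
import Literature.Computability.AlgebraicComplexity.BorderRankCW
import Literature.Computability.AlgebraicComplexity.AsymptoticSpectrum

/-!
# OutsiderSandwich — the Coppersmith–Winograd tower `cw₂^{⊠N}` is POLYSTABLE; relabelling

Route `OutsiderSandwich` (decomp-mm lens 4 «minimal counterexample / extremal reduction», gen 32);
route-independent supply lemmas (no `Theses` import) for `OutsiderSandwichNoPerfectDegeneration`.

* `isPolystableTensor_cwTwoPow N`: the `SL³`-orbit of `cw₂^{⊠N}` is closed, for every `N`.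
  The three one-leg Gram matrices of `cw₂` are `2·1` (`cw_gram_*`, a `3 × 3 × 3` check) and Gram
  matrices are multiplicative under `⊠` (`gram_cwTwoPow_*`: `2^N·1`), so the block embedding
  `emb3 (cw₂^{⊠N})` is critical; `cw₂` has TEST PAIRS (`cw_test_*`: for each letter `y` a pair of
  dual letters `(P y, Q y)` with `cw₂(x, P y, Q y) = [x = y]`), test pairs are multiplicative,
  and they make `cw₂^{⊠N}` concise (`concise_cwTwoPow_*`); the tree's Kempf–Ness packaging
  `isClosed_tripleOrbit_of_gram` then gives the closed orbit.
* `isPolystableTensor_relabel`: polystability is invariant under relabelling the (cubic)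
  format along a bijection, the orbit being relabelled with conjugated matrices
  (`range_sl3_relabel`); `tensorRestrictsTo_of_relabel`: restrictions see through it.

## References

* G. Kempf, L. Ness, *The length of vectors in representation spaces*, LNM 732 (1979), Thm. 0.2.
  [KempfNess1979]
* P. Bürgisser, C. Ikenmeyer, *Fundamental invariants of orbit closures*, J. Algebra 477 (2017),
  §4.2, Cor. 4.9. [BurgisserIkenmeyer2017]
* D. Coppersmith, S. Winograd, *Matrix multiplication via arithmetic progressions*, J. Symbolic
  Comput. 9 (1990), §6. [CoppersmithWinograd1990]
-/

noncomputable section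

open Literature.Computability.AlgebraicComplexity

namespace Summit.MatrixMultiplication.MatrixMultiplication.Theorems.OutsiderSandwichCwTwoPowPolystable

/-! ## Polystability of the Coppersmith–Winograd tower `cw₂^{⊠N}` -/

section CwTwoPow

/- Test pairs of `cw₂`: for each letter `y` the dual pair `(P y, Q y)` with
`P = (fun y => if y = 0 then 1 else 0)` and `Q = (fun y => if y = 0 then 1 else y)`. -/

/-- Test pairs, leg 1: `cw₂(x, P y, Q y) = [x = y]`. [cite: CoppersmithWinograd1990, §6] -/
theorem cw_test_fst (x y : Fin 3) :
    cwTensor ℂ 2 x (if y = 0 then (1 : Fin 3) else 0) (if y = 0 then (1 : Fin 3) else y) = if x = y then 1 else 0 := by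
  fin_cases x <;> fin_cases y <;> simp +decide [cwTensor]

/-- Test pairs, leg 2: `cw₂(P y, x, Q y) = [x = y]`. [cite: CoppersmithWinograd1990, §6] -/
theorem cw_test_snd (x y : Fin 3) :
    cwTensor ℂ 2 (if y = 0 then (1 : Fin 3) else 0) x (if y = 0 then (1 : Fin 3) else y) = if x = y then 1 else 0 := by
  fin_cases x <;> fin_cases y <;> simp +decide [cwTensor]

/-- Test pairs, leg 3: `cw₂(P y, Q y, x) = [x = y]`. [cite: CoppersmithWinograd1990, §6] -/
theorem cw_test_thd (x y : Fin 3) :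
    cwTensor ℂ 2 (if y = 0 then (1 : Fin 3) else 0) (if y = 0 then (1 : Fin 3) else y) x = if x = y then 1 else 0 := by
  fin_cases x <;> fin_cases y <;> simp +decide [cwTensor]

/-- One-leg Gram matrix of `cw₂`, leg 1: `2·1`. [cite: BurgisserIkenmeyer2017, §4.2] -/
theorem cw_gram_fst (x x' : Fin 3) :
    ∑ β : Fin 3, ∑ γ : Fin 3, (starRingEnd ℂ) (cwTensor ℂ 2 x' β γ) * cwTensor ℂ 2 x β γ =
      if x = x' then 2 else 0 := by
  fin_cases x <;> fin_cases x' <;> simp +decide [cwTensor, Fin.sum_univ_three] <;> norm_num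

/-- One-leg Gram matrix of `cw₂`, leg 2: `2·1`. [cite: BurgisserIkenmeyer2017, §4.2] -/
theorem cw_gram_snd (x x' : Fin 3) :
    ∑ α : Fin 3, ∑ γ : Fin 3, (starRingEnd ℂ) (cwTensor ℂ 2 α x' γ) * cwTensor ℂ 2 α x γ =
      if x = x' then 2 else 0 := by
  fin_cases x <;> fin_cases x' <;> simp +decide [cwTensor, Fin.sum_univ_three] <;> norm_num

/-- One-leg Gram matrix of `cw₂`, leg 3: `2·1`. [cite: BurgisserIkenmeyer2017, §4.2] -/
theorem cw_gram_thd (x x' : Fin 3) :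
    ∑ α : Fin 3, ∑ β : Fin 3, (starRingEnd ℂ) (cwTensor ℂ 2 α β x') * cwTensor ℂ 2 α β x =
      if x = x' then 2 else 0 := by
  fin_cases x <;> fin_cases x' <;> simp +decide [cwTensor, Fin.sum_univ_three] <;> norm_num

/-- `∏ᵢ ∑_β ∑_γ G i β γ = ∑_b ∑_c ∏ᵢ G i (b i) (c i)` (distributing a product of double sums).
[folklore] -/
theorem prod_sum_sum {N : ℕ} (G : Fin N → Fin 3 → Fin 3 → ℂ) :
    (∏ i, ∑ β : Fin 3, ∑ γ : Fin 3, G i β γ) =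
      ∑ b : Fin N → Fin 3, ∑ c : Fin N → Fin 3, ∏ i, G i (b i) (c i) := by
  rw [Finset.prod_univ_sum, Fintype.piFinset_univ]
  refine Finset.sum_congr rfl fun b _ => ?_
  rw [Finset.prod_univ_sum, Fintype.piFinset_univ]

/-- `∏ᵢ [a i = a' i]·z = [a = a']·z^N`. [folklore] -/
theorem prod_ite_eq_fun {N : ℕ} (a a' : Fin N → Fin 3) (z : ℂ) :
    (∏ i, (if a i = a' i then z else 0)) = if a = a' then z ^ N else 0 := by
  by_cases h : a = a'
  · subst h
    simp
  · rw [if_neg h]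
    obtain ⟨i, hi⟩ := Function.ne_iff.mp h
    exact Finset.prod_eq_zero (Finset.mem_univ i) (if_neg hi)

/-- One-leg Gram matrix of `cw₂^{⊠N}`, leg 1: `2^N·1`. [cite: BurgisserIkenmeyer2017, §4.2] -/
theorem gram_cwTwoPow_fst (N : ℕ) (a a' : Fin N → Fin 3) :
    ∑ b, ∑ c, (starRingEnd ℂ) (kroneckerPow (cwTensor ℂ 2) N a' b c) *
        kroneckerPow (cwTensor ℂ 2) N a b c = if a = a' then (2 : ℂ) ^ N else 0 := by
  have step : ∀ b c : Fin N → Fin 3, (starRingEnd ℂ) (kroneckerPow (cwTensor ℂ 2) N a' b c) *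
      kroneckerPow (cwTensor ℂ 2) N a b c =
      ∏ i, (starRingEnd ℂ) (cwTensor ℂ 2 (a' i) (b i) (c i)) * cwTensor ℂ 2 (a i) (b i) (c i) := by
    intro b c
    rw [kroneckerPow_apply, kroneckerPow_apply, map_prod, ← Finset.prod_mul_distrib]
  simp_rw [step]
  rw [← prod_sum_sum (fun i β γ => (starRingEnd ℂ) (cwTensor ℂ 2 (a' i) β γ) * cwTensor ℂ 2 (a i) β γ)]
  simp_rw [cw_gram_fst]
  exact prod_ite_eq_fun a a' 2

/-- One-leg Gram matrix of `cw₂^{⊠N}`, leg 2: `2^N·1`. [cite: BurgisserIkenmeyer2017, §4.2] -/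
theorem gram_cwTwoPow_snd (N : ℕ) (b b' : Fin N → Fin 3) :
    ∑ a, ∑ c, (starRingEnd ℂ) (kroneckerPow (cwTensor ℂ 2) N a b' c) *
        kroneckerPow (cwTensor ℂ 2) N a b c = if b = b' then (2 : ℂ) ^ N else 0 := by
  have step : ∀ a c : Fin N → Fin 3, (starRingEnd ℂ) (kroneckerPow (cwTensor ℂ 2) N a b' c) *
      kroneckerPow (cwTensor ℂ 2) N a b c =
      ∏ i, (starRingEnd ℂ) (cwTensor ℂ 2 (a i) (b' i) (c i)) * cwTensor ℂ 2 (a i) (b i) (c i) := by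
    intro a c
    rw [kroneckerPow_apply, kroneckerPow_apply, map_prod, ← Finset.prod_mul_distrib]
  simp_rw [step]
  rw [← prod_sum_sum (fun i α γ => (starRingEnd ℂ) (cwTensor ℂ 2 α (b' i) γ) * cwTensor ℂ 2 α (b i) γ)]
  simp_rw [cw_gram_snd]
  exact prod_ite_eq_fun b b' 2

/-- One-leg Gram matrix of `cw₂^{⊠N}`, leg 3: `2^N·1`. [cite: BurgisserIkenmeyer2017, §4.2] -/
theorem gram_cwTwoPow_thd (N : ℕ) (c c' : Fin N → Fin 3) :
    ∑ a, ∑ b, (starRingEnd ℂ) (kroneckerPow (cwTensor ℂ 2) N a b c') *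
        kroneckerPow (cwTensor ℂ 2) N a b c = if c = c' then (2 : ℂ) ^ N else 0 := by
  have step : ∀ a b : Fin N → Fin 3, (starRingEnd ℂ) (kroneckerPow (cwTensor ℂ 2) N a b c') *
      kroneckerPow (cwTensor ℂ 2) N a b c =
      ∏ i, (starRingEnd ℂ) (cwTensor ℂ 2 (a i) (b i) (c' i)) * cwTensor ℂ 2 (a i) (b i) (c i) := by
    intro a b
    rw [kroneckerPow_apply, kroneckerPow_apply, map_prod, ← Finset.prod_mul_distrib]
  simp_rw [step]
  rw [← prod_sum_sum (fun i α β => (starRingEnd ℂ) (cwTensor ℂ 2 α β (c' i)) * cwTensor ℂ 2 α β (c i))]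
  simp_rw [cw_gram_thd]
  exact prod_ite_eq_fun c c' 2

/-- The power of the test pairs: `cw₂^{⊠N}(a, P∘a₀, Q∘a₀) = [a = a₀]`, leg 1. [folklore] -/
theorem cwTwoPow_test_fst (N : ℕ) (a a₀ : Fin N → Fin 3) :
    kroneckerPow (cwTensor ℂ 2) N a (fun i => if a₀ i = 0 then (1 : Fin 3) else 0) (fun i => if a₀ i = 0 then (1 : Fin 3) else a₀ i) =
      if a = a₀ then 1 else 0 := by
  rw [kroneckerPow_apply]
  simp_rw [cw_test_fst]
  simpa using prod_ite_eq_fun a a₀ 1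

/-- Leg 2. [folklore] -/
theorem cwTwoPow_test_snd (N : ℕ) (b b₀ : Fin N → Fin 3) :
    kroneckerPow (cwTensor ℂ 2) N (fun i => if b₀ i = 0 then (1 : Fin 3) else 0) b (fun i => if b₀ i = 0 then (1 : Fin 3) else b₀ i) =
      if b = b₀ then 1 else 0 := by
  rw [kroneckerPow_apply]
  simp_rw [cw_test_snd]
  simpa using prod_ite_eq_fun b b₀ 1

/-- Leg 3. [folklore] -/
theorem cwTwoPow_test_thd (N : ℕ) (c c₀ : Fin N → Fin 3) :
    kroneckerPow (cwTensor ℂ 2) N (fun i => if c₀ i = 0 then (1 : Fin 3) else 0) (fun i => if c₀ i = 0 then (1 : Fin 3) else c₀ i) c =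
      if c = c₀ then 1 else 0 := by
  rw [kroneckerPow_apply]
  simp_rw [cw_test_thd]
  simpa using prod_ite_eq_fun c c₀ 1

/-- `cw₂^{⊠N}` is concise in leg 1. [cite: CoppersmithWinograd1990, §6] -/
theorem concise_cwTwoPow_fst (N : ℕ) (v : (Fin N → Fin 3) → ℂ)
    (hv : ∀ b c, ∑ a, v a * kroneckerPow (cwTensor ℂ 2) N a b c = 0) : v = 0 := by
  funext a₀
  have h := hv (fun i => if a₀ i = 0 then (1 : Fin 3) else 0) (fun i => if a₀ i = 0 then (1 : Fin 3) else a₀ i)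
  simp_rw [cwTwoPow_test_fst] at h
  simpa using h

/-- `cw₂^{⊠N}` is concise in leg 2. [cite: CoppersmithWinograd1990, §6] -/
theorem concise_cwTwoPow_snd (N : ℕ) (v : (Fin N → Fin 3) → ℂ)
    (hv : ∀ a c, ∑ b, v b * kroneckerPow (cwTensor ℂ 2) N a b c = 0) : v = 0 := by
  funext b₀
  have h := hv (fun i => if b₀ i = 0 then (1 : Fin 3) else 0) (fun i => if b₀ i = 0 then (1 : Fin 3) else b₀ i)
  simp_rw [cwTwoPow_test_snd] at h
  simpa using h

/-- `cw₂^{⊠N}` is concise in leg 3. [cite: CoppersmithWinograd1990, §6] -/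
theorem concise_cwTwoPow_thd (N : ℕ) (v : (Fin N → Fin 3) → ℂ)
    (hv : ∀ a b, ∑ c, v c * kroneckerPow (cwTensor ℂ 2) N a b c = 0) : v = 0 := by
  funext c₀
  have h := hv (fun i => if c₀ i = 0 then (1 : Fin 3) else 0) (fun i => if c₀ i = 0 then (1 : Fin 3) else c₀ i)
  simp_rw [cwTwoPow_test_thd] at h
  simpa using h

/-- **`cw₂^{⊠N}` is polystable** (its `SL³`-orbit is closed): its one-leg Gram matrices are the
scalar `2^N` (critical after the tree's `emb3`) and it is concise, so the tree's Kempf–Ness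
packaging `isClosed_tripleOrbit_of_gram` applies. [cite: KempfNess1979, Thm. 0.2;
BurgisserIkenmeyer2017, §4.2] -/
theorem isPolystableTensor_cwTwoPow (N : ℕ) :
    IsPolystableTensor (kroneckerPow (cwTensor ℂ 2) N) := by
  have h := isClosed_tripleOrbit_of_gram (kroneckerPow (cwTensor ℂ 2) N) (gram_cwTwoPow_fst N)
    (gram_cwTwoPow_snd N) (gram_cwTwoPow_thd N) (concise_cwTwoPow_fst N) (concise_cwTwoPow_snd N)
    (concise_cwTwoPow_thd N)
  unfold IsPolystableTensor
  convert h using 1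
  ext s
  simp only [Set.mem_range, Set.mem_setOf_eq, Prod.exists]
  constructor
  · rintro ⟨A, B, C, rfl⟩
    exact ⟨A, B, C, A.2, B.2, C.2, rfl⟩
  · rintro ⟨A, B, C, hA, hB, hC, rfl⟩
    exact ⟨⟨A, hA⟩, ⟨B, hB⟩, ⟨C, hC⟩, rfl⟩

end CwTwoPow

/-! ## Relabelling a cubic format -/

section Relabel

variable {ι ι' : Type*} [Fintype ι] [DecidableEq ι] [Fintype ι'] [DecidableEq ι']

omit [DecidableEq ι] [DecidableEq ι'] in
/-- The action commutes with relabelling (conjugating the matrices by the bijection).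
[folklore] -/
theorem actTensor_relabel (e : ι' ≃ ι) (A B C : Matrix ι' ι' ℂ) (t : ι → ι → ι → ℂ) :
    actTensor A B C (fun a b c => t (e a) (e b) (e c)) =
      fun a b c => (actTensor (A.submatrix e.symm e.symm) (B.submatrix e.symm e.symm)
        (C.submatrix e.symm e.symm) t) (e a) (e b) (e c) := by
  funext a b c
  simp only [actTensor_apply, Matrix.submatrix_apply, Equiv.symm_apply_apply]
  rw [← e.sum_comp]
  refine Finset.sum_congr rfl fun a' _ => ?_
  rw [← e.sum_comp]
  refine Finset.sum_congr rfl fun b' _ => ?_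
  rw [← e.sum_comp]
  simp only [Equiv.symm_apply_apply]

/-- The `SL³`-orbit of the relabelled tensor is the preimage of the `SL³`-orbit under
un-relabelling. [folklore] -/
theorem range_sl3_relabel (e : ι' ≃ ι) (t : ι → ι → ι → ℂ) :
    (Set.range fun g : Matrix.SpecialLinearGroup ι' ℂ × Matrix.SpecialLinearGroup ι' ℂ ×
        Matrix.SpecialLinearGroup ι' ℂ =>
      actTensor (g.1 : Matrix ι' ι' ℂ) (g.2.1 : Matrix ι' ι' ℂ) (g.2.2 : Matrix ι' ι' ℂ)
        (fun a b c => t (e a) (e b) (e c))) =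
    (fun v : ι' → ι' → ι' → ℂ => fun x y z => v (e.symm x) (e.symm y) (e.symm z)) ⁻¹'
      (Set.range fun g : Matrix.SpecialLinearGroup ι ℂ ×
        Matrix.SpecialLinearGroup ι ℂ × Matrix.SpecialLinearGroup ι ℂ =>
      actTensor (g.1 : Matrix ι ι ℂ) (g.2.1 : Matrix ι ι ℂ) (g.2.2 : Matrix ι ι ℂ) t) := by
  ext w
  simp only [Set.mem_preimage, Set.mem_range]
  constructor
  · rintro ⟨g, rfl⟩
    refine ⟨(⟨(g.1 : Matrix ι' ι' ℂ).submatrix e.symm e.symm, ?_⟩,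
        ⟨(g.2.1 : Matrix ι' ι' ℂ).submatrix e.symm e.symm, ?_⟩,
        ⟨(g.2.2 : Matrix ι' ι' ℂ).submatrix e.symm e.symm, ?_⟩), ?_⟩
    · rw [Matrix.det_submatrix_equiv_self]
      exact Matrix.SpecialLinearGroup.det_coe _
    · rw [Matrix.det_submatrix_equiv_self]
      exact Matrix.SpecialLinearGroup.det_coe _
    · rw [Matrix.det_submatrix_equiv_self]
      exact Matrix.SpecialLinearGroup.det_coe _
    · have h := actTensor_relabel e (g.1 : Matrix ι' ι' ℂ) (g.2.1 : Matrix ι' ι' ℂ)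
        (g.2.2 : Matrix ι' ι' ℂ) t
      show actTensor _ _ _ t = fun x y z => actTensor _ _ _ _ (e.symm x) (e.symm y) (e.symm z)
      rw [h]
      funext x y z
      simp only [Equiv.apply_symm_apply]
  · rintro ⟨g, hg⟩
    refine ⟨(⟨(g.1 : Matrix ι ι ℂ).submatrix e e, ?_⟩, ⟨(g.2.1 : Matrix ι ι ℂ).submatrix e e, ?_⟩,
      ⟨(g.2.2 : Matrix ι ι ℂ).submatrix e e, ?_⟩), ?_⟩
    · rw [Matrix.det_submatrix_equiv_self]
      exact Matrix.SpecialLinearGroup.det_coe _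
    · rw [Matrix.det_submatrix_equiv_self]
      exact Matrix.SpecialLinearGroup.det_coe _
    · rw [Matrix.det_submatrix_equiv_self]
      exact Matrix.SpecialLinearGroup.det_coe _
    · have h := actTensor_relabel e ((g.1 : Matrix ι ι ℂ).submatrix e e)
        ((g.2.1 : Matrix ι ι ℂ).submatrix e e) ((g.2.2 : Matrix ι ι ℂ).submatrix e e) t
      simp only [Matrix.submatrix_submatrix, Equiv.self_comp_symm, Matrix.submatrix_id_id] at h
      have hg' : actTensor (g.1 : Matrix ι ι ℂ) (g.2.1 : Matrix ι ι ℂ) (g.2.2 : Matrix ι ι ℂ) t =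
          fun x y z => w (e.symm x) (e.symm y) (e.symm z) := hg
      show actTensor _ _ _ _ = w
      rw [h, hg']
      funext a b c
      simp only [Equiv.symm_apply_apply]

/-- **Polystability is invariant under relabelling** the format along a bijection.
[cite: BurgisserIkenmeyer2017, §4.2] -/
theorem isPolystableTensor_relabel (e : ι' ≃ ι) {t : ι → ι → ι → ℂ}
    (ht : IsPolystableTensor t) : IsPolystableTensor (fun a b c => t (e a) (e b) (e c)) := by
  unfold IsPolystableTensor at ht ⊢
  rw [range_sl3_relabel]
  refine ht.preimage ?_
  refine continuous_pi fun x => continuous_pi fun y => continuous_pi fun z => ?_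
  exact (continuous_apply (e.symm z)).comp ((continuous_apply (e.symm y)).comp
    (continuous_apply (e.symm x)))

omit [Fintype ι] [DecidableEq ι] [Fintype ι'] [DecidableEq ι'] in
/-- Restriction to a relabelled target is restriction to the target. [folklore] -/
theorem tensorRestrictsTo_of_relabel {κ₁ κ₂ κ₃ : Type*} [Fintype κ₁] [Fintype κ₂]
    [Fintype κ₃] {s : κ₁ → κ₂ → κ₃ → ℂ} (e : ι' ≃ ι) {t : ι → ι → ι → ℂ}
    (h : TensorRestrictsTo s (fun a b c => t (e a) (e b) (e c))) : TensorRestrictsTo s t := by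
  obtain ⟨A, B, C, h⟩ := h
  refine ⟨fun x a => A (e.symm x) a, fun y b => B (e.symm y) b, fun z c => C (e.symm z) c,
    fun x y z => ?_⟩
  have := h (e.symm x) (e.symm y) (e.symm z)
  simp only [Equiv.apply_symm_apply] at this
  exact this

end Relabel

end Summit.MatrixMultiplication.MatrixMultiplication.Theorems.OutsiderSandwichCwTwoPowPolystable

end
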